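import Mathlib
import HarnessLib
import Summits.HubbardSuperconductivity.HubbardSuperconductivity.Theorems.KLProgrammeKLRegimeSplitTwoLegSizesMSWithPiecesLTube
import Summits.HubbardSuperconductivity.HubbardSuperconductivity.Theorems.KLProgrammeKLRegimeSplitTwoLegSizesMSScaleZero

/-!
# Route `KLProgramme`, crux K3 — (E3a-MS) supplier chain, TUBE RE-KEY (T5b): the `…MSQ` / `…MSLowMixed` / `…MSProfiles` / `…MSScaleZero`
# suppliers with the increment-symbol sizes on the flat tube `{|frameLevel μ K| ≤ dT}` (k3c3-p1 g4)

Seat hubbard-kl-k3c3-p1 (g4).  One-line twins over `…MSWithPiecesLTube`: every theorem below is its global-size namesake with `hσ0/hσ/hε0/hε`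
re-keyed to `∀ q, |frameLevel μ K q| ≤ dT → …` and the two extra binders `hGl : ‖D frameLevel μ K‖ ≤ G_l`, `hdT : msTubeR R U n₀ G_l ≤ dT`
(`msTubeR R U n₀ G_l = 8·Gfr₀|U|·16^{−n₀}/15·(1 + G_l/klCurveD)`); conclusions unchanged.

* `twoLegSizesMSTQ_succ/zero_of_pieces_tube` (Λ-parametric, fits as hypotheses), `twoLegSizesMSTQ_succ/zero_of_pieces_mixed_tube` (Λ discharged),
  **`twoLegSizesMSTQ_succ_of_profiles_tube`**, **`twoLegSizesMSTQ_zero_of_profiles_tube`** (fits discharged from the engine profiles + package lines).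

Proofs only; nothing about the model.
-/

noncomputable section

namespace Summit.HubbardSuperconductivity.HubbardSuperconductivity.Theorems.KLRegimeSplit

set_option linter.dupNamespace false -- summit = problem name (single-conjunct summit), D-0017

open Real Finset Literature.MathematicalPhysics.QuantumLattice Literature.MathematicalPhysics.QuantumLattice.FermiRG
open Literature.MathematicalPhysics.QuantumLattice.BandSectorCounting
open Summit.HubbardSuperconductivity.HubbardSuperconductivity.Theorems.KLProgrammeLegKernels
open Summit.HubbardSuperconductivity.HubbardSuperconductivity.Theorems.DispersionFlow
open Summit.HubbardSuperconductivity.HubbardSuperconductivity.Theorems.PerturbedFermiCurve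

section MS

variable {L M : ℕ} [NeZero L] [NeZero M] {G : GeoConsts} {Q : EngConsts} {R : RenConsts} {β U μ : ℝ}

/-- **(E3a-MS-TQ) AT SCALE `n+1`, pieces-keyed, Λ-parametric, TUBE symbol sizes** (low-part totals `Λ₃, Λ₄` as hypotheses; depth-graded,
oscillation-entry fits).  See the module docstring. -/
theorem twoLegSizesMSTQ_succ_of_pieces_tube (hR : ∀ j, 0 ≤ R.Gfr j) {c : ℝ} (hc : 0 < c) (hcle : c ≤ klCurveC3 R / 16)
    (hU : 0 < U) (hUle : U ≤ klCurveU0 R / 16) (hβmin : klBetaMin ≤ β) (hβc : β ≤ Real.exp (c / U ^ 2)) (hμ : μ ∈ klWindowC)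
    {K : TrigPolyC4v} {Kp : ℕ → TrigPolyC4v} (hK : ∀ p : Fin 2 → ℝ, K.eval p = ∑ m ∈ range (nScales β + 1), (Kp m).eval p)
    (ha : ∀ m ≤ nScales β, ∀ j ≤ 4, ∀ q : Momentum, ‖iteratedFDeriv ℝ j (evalM (Kp m)) q‖ ≤ pieceSize R U m j)
    {n : ℕ} (hn : n + 1 ≤ nScales β) (d : ℕ)
    {Λ₃ : ℝ} (hΛ₃ : ∀ q : Momentum, ∑ m ∈ Ioc (n + 1) (nScales β), ‖iteratedFDeriv ℝ 3 (evalM (lowPart d (Kp m))) q‖ ≤ Λ₃)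
    {Λ₄ : ℝ} (hΛ₄ : ∀ q : Momentum, ∑ m ∈ Ioc (n + 1) (nScales β), ‖iteratedFDeriv ℝ 4 (evalM (lowPart d (Kp m))) q‖ ≤ Λ₄)
    (hc₁ : Continuous (klLocalPart L M β U μ K (n + 1))) (hc₀ : Continuous (klLocalPart L M β U μ K n))
    {S : ℕ → TrigPolyC4v}
    (hS : ∀ θ, klLocalPart L M β U μ K (n + 1) θ - klLocalPart L M β U μ K n θ =
      (S (nScales β - (n + 1))).eval (klFermiPoint μ K θ))
    {dT : ℝ} {σ : ℕ → ℕ → ℝ} (hσnn : ∀ k l, 0 ≤ σ k l)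
    (hσ0 : ∀ k ≤ nScales β - (n + 1), ∀ q : Momentum, |frameLevel μ K q| ≤ dT → |evalM (S k) q| ≤ σ k 0)
    (hσ : ∀ k ≤ nScales β - (n + 1), ∀ l, 1 ≤ l → l ≤ 5 → ∀ q : Momentum, |frameLevel μ K q| ≤ dT → ‖iteratedFDeriv ℝ l (evalM (S k)) q‖ ≤ σ k l)
    {ε : ℕ → ℕ → ℝ} (hεnn : ∀ m l, 0 ≤ ε m l)
    (hε0 : ∀ m ∈ Ioc (n + 1) (nScales β), ∀ q : Momentum,
      |frameLevel μ K q| ≤ dT → |evalM (fsub (S (m - (n + 1))) (S (m - (n + 1) - 1))) q| ≤ ε m 0)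
    (hε : ∀ m ∈ Ioc (n + 1) (nScales β), ∀ l, 1 ≤ l → l ≤ 4 → ∀ q : Momentum,
      |frameLevel μ K q| ≤ dT → ‖iteratedFDeriv ℝ l (evalM (fsub (S (m - (n + 1))) (S (m - (n + 1) - 1)))) q‖ ≤ ε m l)
    {X : ℝ} (hX : ∀ l ≤ 4, ∀ x : ℝ, ‖iteratedFDeriv ℝ l salmhoferCutoff x‖ ≤ X)
    {Gl : ℝ} (hGl : ∀ q : Momentum, ‖fderiv ℝ (frameLevel μ K) q‖ ≤ Gl) (hdT : msTubeR R U (n + 1) Gl ≤ dT)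
    (hfit_n : ∀ j ≤ 4, msPieceBaseL X σ R U (n + 1) Λ₃ Λ₄ j ≤ twoLegBar G Q U j (n + 1))
    (hfit_m : ∀ m ∈ Ioc (n + 1) (nScales β), ∀ j ≤ 4,
      msPieceSlotL X σ ε R c U d (n + 1) Λ₃ Λ₄ m j ≤ msBarQ G Q U (n + 1) * (R.Gfr j * uPow j U * (4 : ℝ) ^ (((j : ℤ) - 2) * m))) :
    TwoLegSizesMSTQ L M G Q R β U μ K (n + 1) :=
  (twoLegSizesMSWith_succ_of_pieces_L_tube hR hc hcle hU hUle hβmin hβc hμ hK ha hn d hΛ₃ hΛ₄ hc₁ hc₀ hS hσnn hσ0 hσ hεnn hε0 hε hX hGl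
    hdT).toMSTQ
    hfit_n hfit_m

/-- **(E3a-MS-TQ) AT SCALE `0` IN THE KL REGIME, KEYED BY THE ADMISSIBLE PIECES** (low-part totals `Λ₃, Λ₄` as hypotheses). -/
theorem twoLegSizesMSTQ_zero_of_pieces_tube (hR : ∀ j, 0 ≤ R.Gfr j) {c : ℝ} (hc : 0 < c) (hcle : c ≤ klCurveC3 R / 16)
    (hU : 0 < U) (hUle : U ≤ klCurveU0 R / 16) (hβmin : klBetaMin ≤ β) (hβc : β ≤ Real.exp (c / U ^ 2)) (hμ : μ ∈ klWindowC)
    {K : TrigPolyC4v} {Kp : ℕ → TrigPolyC4v} (hK : ∀ p : Fin 2 → ℝ, K.eval p = ∑ m ∈ range (nScales β + 1), (Kp m).eval p)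
    (ha : ∀ m ≤ nScales β, ∀ j ≤ 4, ∀ q : Momentum, ‖iteratedFDeriv ℝ j (evalM (Kp m)) q‖ ≤ pieceSize R U m j)
    (d : ℕ)
    {Λ₃ : ℝ} (hΛ₃ : ∀ q : Momentum, ∑ m ∈ Ioc 0 (nScales β), ‖iteratedFDeriv ℝ 3 (evalM (lowPart d (Kp m))) q‖ ≤ Λ₃)
    {Λ₄ : ℝ} (hΛ₄ : ∀ q : Momentum, ∑ m ∈ Ioc 0 (nScales β), ‖iteratedFDeriv ℝ 4 (evalM (lowPart d (Kp m))) q‖ ≤ Λ₄)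
    (hc₀ : Continuous (klLocalPart L M β U μ K 0))
    {S : ℕ → TrigPolyC4v}
    (hS : ∀ θ, klLocalPart L M β U μ K 0 θ - K.eval (klFermiPoint μ K θ) = (S (nScales β)).eval (klFermiPoint μ K θ))
    {dT : ℝ} {σ : ℕ → ℕ → ℝ} (hσnn : ∀ k l, 0 ≤ σ k l)
    (hσ0 : ∀ k ≤ nScales β, ∀ q : Momentum, |frameLevel μ K q| ≤ dT → |evalM (S k) q| ≤ σ k 0)
    (hσ : ∀ k ≤ nScales β, ∀ l, 1 ≤ l → l ≤ 5 → ∀ q : Momentum, |frameLevel μ K q| ≤ dT → ‖iteratedFDeriv ℝ l (evalM (S k)) q‖ ≤ σ k l)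
    {ε : ℕ → ℕ → ℝ} (hεnn : ∀ m l, 0 ≤ ε m l)
    (hε0 : ∀ m ∈ Ioc 0 (nScales β), ∀ q : Momentum,
      |frameLevel μ K q| ≤ dT → |evalM (fsub (S m) (S (m - 1))) q| ≤ ε m 0)
    (hε : ∀ m ∈ Ioc 0 (nScales β), ∀ l, 1 ≤ l → l ≤ 4 → ∀ q : Momentum,
      |frameLevel μ K q| ≤ dT → ‖iteratedFDeriv ℝ l (evalM (fsub (S m) (S (m - 1)))) q‖ ≤ ε m l)
    {X : ℝ} (hX : ∀ l ≤ 4, ∀ x : ℝ, ‖iteratedFDeriv ℝ l salmhoferCutoff x‖ ≤ X)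
    {Gl : ℝ} (hGl : ∀ q : Momentum, ‖fderiv ℝ (frameLevel μ K) q‖ ≤ Gl) (hdT : msTubeR R U 0 Gl ≤ dT)
    (hfit_n : ∀ j ≤ 4, msPieceBaseL X σ R U 0 Λ₃ Λ₄ j ≤ twoLegBar G Q U j 0)
    (hfit_m : ∀ m ∈ Ioc 0 (nScales β), ∀ j ≤ 4,
      msPieceSlotL X σ ε R c U d 0 Λ₃ Λ₄ m j ≤ msBarQ G Q U 0 * (R.Gfr j * uPow j U * (4 : ℝ) ^ (((j : ℤ) - 2) * m))) :
    TwoLegSizesMSTQ L M G Q R β U μ K 0 :=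
  (twoLegSizesMSWith_zero_of_pieces_L_tube hR hc hcle hU hUle hβmin hβc hμ hK ha d hΛ₃ hΛ₄ hc₀ hS hσnn hσ0 hσ hεnn hε0 hε hX hGl
    hdT).toMSTQ
    hfit_n hfit_m

/-- **(E3a-MS-TQ) AT SCALE `n+1`, NO LOW-PART HYPOTHESIS LEFT**: `twoLegSizesMSTQ_succ_of_pieces` with `Λ₃ := msLam R U d (n+1) 3`,
`Λ₄ := msLam R U d (n+1) 4` discharged by `sum_norm_iteratedFDeriv_lowPart_le_msLam`. -/
theorem twoLegSizesMSTQ_succ_of_pieces_mixed_tube (hR : ∀ j, 0 ≤ R.Gfr j) {c : ℝ} (hc : 0 < c) (hcle : c ≤ klCurveC3 R / 16)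
    (hU : 0 < U) (hUle : U ≤ klCurveU0 R / 16) (hβmin : klBetaMin ≤ β) (hβc : β ≤ Real.exp (c / U ^ 2)) (hμ : μ ∈ klWindowC)
    {K : TrigPolyC4v} {Kp : ℕ → TrigPolyC4v} (hK : ∀ p : Fin 2 → ℝ, K.eval p = ∑ m ∈ range (nScales β + 1), (Kp m).eval p)
    (ha : ∀ m ≤ nScales β, ∀ j ≤ 4, ∀ q : Momentum, ‖iteratedFDeriv ℝ j (evalM (Kp m)) q‖ ≤ pieceSize R U m j)
    {n : ℕ} (hn : n + 1 ≤ nScales β) (d : ℕ)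
    (hc₁ : Continuous (klLocalPart L M β U μ K (n + 1))) (hc₀ : Continuous (klLocalPart L M β U μ K n))
    {S : ℕ → TrigPolyC4v}
    (hS : ∀ θ, klLocalPart L M β U μ K (n + 1) θ - klLocalPart L M β U μ K n θ =
      (S (nScales β - (n + 1))).eval (klFermiPoint μ K θ))
    {dT : ℝ} {σ : ℕ → ℕ → ℝ} (hσnn : ∀ k l, 0 ≤ σ k l)
    (hσ0 : ∀ k ≤ nScales β - (n + 1), ∀ q : Momentum, |frameLevel μ K q| ≤ dT → |evalM (S k) q| ≤ σ k 0)
    (hσ : ∀ k ≤ nScales β - (n + 1), ∀ l, 1 ≤ l → l ≤ 5 → ∀ q : Momentum, |frameLevel μ K q| ≤ dT → ‖iteratedFDeriv ℝ l (evalM (S k)) q‖ ≤ σ k l)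
    {ε : ℕ → ℕ → ℝ} (hεnn : ∀ m l, 0 ≤ ε m l)
    (hε0 : ∀ m ∈ Ioc (n + 1) (nScales β), ∀ q : Momentum,
      |frameLevel μ K q| ≤ dT → |evalM (fsub (S (m - (n + 1))) (S (m - (n + 1) - 1))) q| ≤ ε m 0)
    (hε : ∀ m ∈ Ioc (n + 1) (nScales β), ∀ l, 1 ≤ l → l ≤ 4 → ∀ q : Momentum,
      |frameLevel μ K q| ≤ dT → ‖iteratedFDeriv ℝ l (evalM (fsub (S (m - (n + 1))) (S (m - (n + 1) - 1)))) q‖ ≤ ε m l)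
    {X : ℝ} (hX : ∀ l ≤ 4, ∀ x : ℝ, ‖iteratedFDeriv ℝ l salmhoferCutoff x‖ ≤ X)
    {Gl : ℝ} (hGl : ∀ q : Momentum, ‖fderiv ℝ (frameLevel μ K) q‖ ≤ Gl) (hdT : msTubeR R U (n + 1) Gl ≤ dT)
    (hfit_n : ∀ j ≤ 4, msPieceBaseL X σ R U (n + 1) (msLam R U d (n + 1) 3) (msLam R U d (n + 1) 4) j ≤ twoLegBar G Q U j (n + 1))
    (hfit_m : ∀ m ∈ Ioc (n + 1) (nScales β), ∀ j ≤ 4,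
      msPieceSlotL X σ ε R c U d (n + 1) (msLam R U d (n + 1) 3) (msLam R U d (n + 1) 4) m j ≤
        msBarQ G Q U (n + 1) * (R.Gfr j * uPow j U * (4 : ℝ) ^ (((j : ℤ) - 2) * m))) :
    TwoLegSizesMSTQ L M G Q R β U μ K (n + 1) :=
  twoLegSizesMSTQ_succ_of_pieces_tube hR hc hcle hU hUle hβmin hβc hμ hK ha hn d
    (fun q => sum_norm_iteratedFDeriv_lowPart_le_msLam d hR ha (by norm_num) (by norm_num) q)
    (fun q => sum_norm_iteratedFDeriv_lowPart_le_msLam d hR ha (by norm_num) le_rfl q)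
    hc₁ hc₀ hS hσnn hσ0 hσ hεnn hε0 hε hX hGl hdT hfit_n hfit_m

/-- **(E3a-MS-TQ) AT SCALE `0`, NO LOW-PART HYPOTHESIS LEFT.** -/
theorem twoLegSizesMSTQ_zero_of_pieces_mixed_tube (hR : ∀ j, 0 ≤ R.Gfr j) {c : ℝ} (hc : 0 < c) (hcle : c ≤ klCurveC3 R / 16)
    (hU : 0 < U) (hUle : U ≤ klCurveU0 R / 16) (hβmin : klBetaMin ≤ β) (hβc : β ≤ Real.exp (c / U ^ 2)) (hμ : μ ∈ klWindowC)
    {K : TrigPolyC4v} {Kp : ℕ → TrigPolyC4v} (hK : ∀ p : Fin 2 → ℝ, K.eval p = ∑ m ∈ range (nScales β + 1), (Kp m).eval p)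
    (ha : ∀ m ≤ nScales β, ∀ j ≤ 4, ∀ q : Momentum, ‖iteratedFDeriv ℝ j (evalM (Kp m)) q‖ ≤ pieceSize R U m j)
    (d : ℕ) (hc₀ : Continuous (klLocalPart L M β U μ K 0))
    {S : ℕ → TrigPolyC4v}
    (hS : ∀ θ, klLocalPart L M β U μ K 0 θ - K.eval (klFermiPoint μ K θ) = (S (nScales β)).eval (klFermiPoint μ K θ))
    {dT : ℝ} {σ : ℕ → ℕ → ℝ} (hσnn : ∀ k l, 0 ≤ σ k l)
    (hσ0 : ∀ k ≤ nScales β, ∀ q : Momentum, |frameLevel μ K q| ≤ dT → |evalM (S k) q| ≤ σ k 0)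
    (hσ : ∀ k ≤ nScales β, ∀ l, 1 ≤ l → l ≤ 5 → ∀ q : Momentum, |frameLevel μ K q| ≤ dT → ‖iteratedFDeriv ℝ l (evalM (S k)) q‖ ≤ σ k l)
    {ε : ℕ → ℕ → ℝ} (hεnn : ∀ m l, 0 ≤ ε m l)
    (hε0 : ∀ m ∈ Ioc 0 (nScales β), ∀ q : Momentum,
      |frameLevel μ K q| ≤ dT → |evalM (fsub (S m) (S (m - 1))) q| ≤ ε m 0)
    (hε : ∀ m ∈ Ioc 0 (nScales β), ∀ l, 1 ≤ l → l ≤ 4 → ∀ q : Momentum,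
      |frameLevel μ K q| ≤ dT → ‖iteratedFDeriv ℝ l (evalM (fsub (S m) (S (m - 1)))) q‖ ≤ ε m l)
    {X : ℝ} (hX : ∀ l ≤ 4, ∀ x : ℝ, ‖iteratedFDeriv ℝ l salmhoferCutoff x‖ ≤ X)
    {Gl : ℝ} (hGl : ∀ q : Momentum, ‖fderiv ℝ (frameLevel μ K) q‖ ≤ Gl) (hdT : msTubeR R U 0 Gl ≤ dT)
    (hfit_n : ∀ j ≤ 4, msPieceBaseL X σ R U 0 (msLam R U d 0 3) (msLam R U d 0 4) j ≤ twoLegBar G Q U j 0)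
    (hfit_m : ∀ m ∈ Ioc 0 (nScales β), ∀ j ≤ 4,
      msPieceSlotL X σ ε R c U d 0 (msLam R U d 0 3) (msLam R U d 0 4) m j ≤ msBarQ G Q U 0 * (R.Gfr j * uPow j U * (4 : ℝ) ^ (((j : ℤ) - 2) * m))) :
    TwoLegSizesMSTQ L M G Q R β U μ K 0 :=
  twoLegSizesMSTQ_zero_of_pieces_tube hR hc hcle hU hUle hβmin hβc hμ hK ha d
    (fun q => sum_norm_iteratedFDeriv_lowPart_le_msLam d hR ha (by norm_num) (by norm_num) q)
    (fun q => sum_norm_iteratedFDeriv_lowPart_le_msLam d hR ha (by norm_num) le_rfl q)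
    hc₀ hS hσnn hσ0 hσ hεnn hε0 hε hX hGl hdT hfit_n hfit_m

/-- **(E3a-MS-TQ) AT THE SCALES `n + 1 ≤ n_β` FROM THE ENGINE PROFILES** — `TwoLegSizesMSTQ L M G Q R β U μ K (n+1)` with NO fit and NO low-part
hypothesis: the Λ-supplier `twoLegSizesMSTQ_succ_of_pieces_mixed` at `d = 4^{n+1}`, its fits discharged by `msPieceBaseL_le` / `msPieceSlotL_le`
(k3c3-p3) at `lam3 = 512π⁸`, `lam4 = 2048π⁸` (`msLam_three_le` / `msLam_four_le`). -/
theorem twoLegSizesMSTQ_succ_of_profiles_tube (hR : ∀ j, 0 ≤ R.Gfr j) {c : ℝ} (hc : 0 < c) (hcle : c ≤ klCurveC3 R / 16)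
    (hU : 0 < U) (hUle : U ≤ klCurveU0 R / 16) (hU1 : U ≤ 1) (hβmin : klBetaMin ≤ β) (hβc : β ≤ Real.exp (c / U ^ 2))
    (hμ : μ ∈ klWindowC)
    {K : TrigPolyC4v} {Kp : ℕ → TrigPolyC4v} (hK : ∀ p : Fin 2 → ℝ, K.eval p = ∑ m ∈ range (nScales β + 1), (Kp m).eval p)
    (ha : ∀ m ≤ nScales β, ∀ j ≤ 4, ∀ q : Momentum, ‖iteratedFDeriv ℝ j (evalM (Kp m)) q‖ ≤ pieceSize R U m j)
    {n : ℕ} (hn : n + 1 ≤ nScales β)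
    (hc₁ : Continuous (klLocalPart L M β U μ K (n + 1))) (hc₀ : Continuous (klLocalPart L M β U μ K n))
    {S : ℕ → TrigPolyC4v}
    (hS : ∀ θ, klLocalPart L M β U μ K (n + 1) θ - klLocalPart L M β U μ K n θ =
      (S (nScales β - (n + 1))).eval (klFermiPoint μ K θ))
    {dT : ℝ} {σ : ℕ → ℕ → ℝ} (hσnn : ∀ k l, 0 ≤ σ k l)
    (hσ0 : ∀ k ≤ nScales β - (n + 1), ∀ q : Momentum, |frameLevel μ K q| ≤ dT → |evalM (S k) q| ≤ σ k 0)
    (hσ : ∀ k ≤ nScales β - (n + 1), ∀ l, 1 ≤ l → l ≤ 5 → ∀ q : Momentum, |frameLevel μ K q| ≤ dT → ‖iteratedFDeriv ℝ l (evalM (S k)) q‖ ≤ σ k l)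
    {ε : ℕ → ℕ → ℝ} (hεnn : ∀ m l, 0 ≤ ε m l)
    (hε0 : ∀ m ∈ Ioc (n + 1) (nScales β), ∀ q : Momentum,
      |frameLevel μ K q| ≤ dT → |evalM (fsub (S (m - (n + 1))) (S (m - (n + 1) - 1))) q| ≤ ε m 0)
    (hε : ∀ m ∈ Ioc (n + 1) (nScales β), ∀ l, 1 ≤ l → l ≤ 4 → ∀ q : Momentum,
      |frameLevel μ K q| ≤ dT → ‖iteratedFDeriv ℝ l (evalM (fsub (S (m - (n + 1))) (S (m - (n + 1) - 1)))) q‖ ≤ ε m l)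
    {X : ℝ} (hX : ∀ l ≤ 4, ∀ x : ℝ, ‖iteratedFDeriv ℝ l salmhoferCutoff x‖ ≤ X)
    {Gl : ℝ} (hGl : ∀ q : Momentum, ‖fderiv ℝ (frameLevel μ K) q‖ ≤ Gl) (hdT : msTubeR R U (n + 1) Gl ≤ dT)
    (hCE : 0 ≤ Q.CE) (hS' : ∀ j, 0 ≤ Q.S' j)
    {mu nu : ℕ → ℝ} (hmu : ∀ i, 0 ≤ mu i) (hnu : ∀ i, 0 ≤ nu i)
    (hs0 : σ 0 0 ≤ 16 * mu 0 * U ^ 2 / ((4 : ℝ) ^ (n + 1)) ^ 2)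
    (hs1 : ∀ k ≤ nScales β - (n + 1), σ k 1 ≤ 4 * mu 1 * U ^ 2 / ((4 : ℝ) ^ (n + 1)))
    (hs2 : ∀ k ≤ nScales β - (n + 1), σ k 2 ≤ mu 2 * U ^ 2)
    (hs3 : ∀ k ≤ nScales β - (n + 1), σ k 3 ≤ mu 3 * U ^ 2 * ((4 : ℝ) ^ (n + 1)) / 4)
    (hs4 : ∀ k ≤ nScales β - (n + 1), σ k 4 ≤ mu 4 * U ^ 2 * ((4 : ℝ) ^ (n + 1)) ^ 2 / 16)
    (hs5 : ∀ k ≤ nScales β - (n + 1), σ k 5 ≤ mu 5 * U ^ 2 * ((4 : ℝ) ^ (n + 1)) ^ 3 / 64)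
    (he0 : ∀ m ∈ Ioc (n + 1) (nScales β), ε m 0 ≤ nu 0 * U ^ 2 / ((4 : ℝ) ^ (n + 1)) * (R.Gfr 0 * U / ((4 : ℝ) ^ m) ^ 2))
    (he1 : ∀ m ∈ Ioc (n + 1) (nScales β), ε m 1 ≤ nu 1 * U ^ 2 / ((4 : ℝ) ^ (n + 1)) * (R.Gfr 1 * U ^ 2 / ((4 : ℝ) ^ m)))
    (he2 : ∀ m ∈ Ioc (n + 1) (nScales β), ε m 2 ≤ nu 2 * U ^ 2 / ((4 : ℝ) ^ (n + 1)) * (R.Gfr 2 * U ^ 2))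
    (he3 : ∀ m ∈ Ioc (n + 1) (nScales β), ε m 3 ≤ nu 3 * U ^ 2 / ((4 : ℝ) ^ (n + 1)) * (R.Gfr 3 * U ^ 2 * ((4 : ℝ) ^ m)))
    (he4 : ∀ m ∈ Ioc (n + 1) (nScales β), ε m 4 ≤ nu 4 * U ^ 2 / ((4 : ℝ) ^ (n + 1)) * (R.Gfr 4 * U ^ 2 * ((4 : ℝ) ^ m) ^ 2))
    (hfit : ∀ j ≤ 4, msReqSlot X mu nu R (512 * π ^ 8) (2048 * π ^ 8) j ≤ Q.CE * G.S 1 * R.Gfr j)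
    (hfit0 : ∀ j ≤ 4, msReqBase0 X mu j ≤ G.S j / 2)
    (hfit1 : ∀ j ≤ 4, U * msReqBase1 X mu R (512 * π ^ 8) (2048 * π ^ 8) j ≤ G.S j / 2) :
    TwoLegSizesMSTQ L M G Q R β U μ K (n + 1) := by
  -- the chain regime at scale `n + 1`
  have hreg := chain_regime_of_pieces_graded hR hc hcle hU hUle hβmin hβc hμ ha (4 ^ (n + 1)) hn
  have hA0 : 0 ≤ msA R c U := msA_nonneg hR hc.le U
  have hA20 : msA R c U ≤ 1 / 20 := hreg.2.1
  have hd : klCurveD ≤ msDt - 2 * msA R c U := hreg.2.2.1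
  have hX0 : 0 ≤ X := le_trans (norm_nonneg _) (hX 0 (by norm_num) 0)
  have hn₀ : 1 ≤ n + 1 := Nat.succ_pos n
  have hlam3 : (0 : ℝ) ≤ 512 * π ^ 8 := by positivity
  have hlam4 : (0 : ℝ) ≤ 2048 * π ^ 8 := by positivity
  -- the Λ-shapes at `d = 4^{n+1}`
  have hΛ₃0 := msLam_nonneg hR U (4 ^ (n + 1)) (n + 1) 3
  have hΛ₄0 := msLam_nonneg hR U (4 ^ (n + 1)) (n + 1) 4
  have hΛ₃ := msLam_three_le hR U (n + 1)
  have hΛ₄ := msLam_four_le hR U (n + 1)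
  refine twoLegSizesMSTQ_succ_of_pieces_mixed_tube hR hc hcle hU hUle hβmin hβc hμ hK ha hn (4 ^ (n + 1)) hc₁ hc₀ hS hσnn hσ0 hσ
    hεnn hε0 hε hX hGl hdT ?_ ?_
  · -- base fits
    exact msPieceBaseL_le (hR := hR) (hU := hU) (hU1 := hU1) (hn₀ := hn₀) (hX := hX0) (hlam3 := hlam3) (hlam4 := hlam4)
      (hS' := hS') (hμ := hmu) (hΛ₃0 := hΛ₃0) (hΛ₃ := hΛ₃) (hΛ₄0 := hΛ₄0) (hΛ₄ := hΛ₄) (hσ0 := hσnn)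
      (hs0 := hs0) (hs1 := hs1 0 (Nat.zero_le _)) (hs2 := hs2 0 (Nat.zero_le _)) (hs3 := hs3 0 (Nat.zero_le _))
      (hs4 := hs4 0 (Nat.zero_le _)) (hfit0 := hfit0) (hfit1 := hfit1)
  · -- slot fits
    intro m hm
    have hm' : n + 1 + 1 ≤ m := (mem_Ioc.mp hm).1
    have hk : m - (n + 1) - 1 ≤ nScales β - (n + 1) := by have := (mem_Ioc.mp hm).2; omega
    exact msPieceSlotL_le (hR := hR) (hU := hU) (hU1 := hU1) (hn₀ := hn₀) (hm := hm') (hX := hX0) (hlam3 := hlam3) (hlam4 := hlam4)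
      (hCE := hCE) (hS1' := hS' 1) (hμ := hmu) (hν := hnu) (hA0 := hA0) (hA20 := hA20) (hd := hd)
      (hΛ₃0 := hΛ₃0) (hΛ₃ := hΛ₃) (hΛ₄0 := hΛ₄0) (hΛ₄ := hΛ₄) (hσ0 := hσnn)
      (hs1 := hs1 _ hk) (hs2 := hs2 _ hk) (hs3 := hs3 _ hk) (hs4 := hs4 _ hk) (hs5 := hs5 _ hk) (hε0 := hεnn)
      (he0 := he0 m hm) (he1 := he1 m hm) (he2 := he2 m hm) (he3 := he3 m hm) (he4 := he4 m hm) (hfit := hfit)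

/-- **(E3a-MS-TQ) AT SCALE `0` FROM THE ENGINE PROFILES** — `TwoLegSizesMSTQ L M G Q R β U μ K 0` with NO fit and NO low-part hypothesis:
the Λ-supplier `twoLegSizesMSTQ_zero_of_pieces_mixed` at `d = 4^0`, its fits discharged by `msPieceBaseL_le_scaleZero` / `msPieceSlotL_le_scaleZero`
at `lam3 = lam4 = 8π⁸`. -/
theorem twoLegSizesMSTQ_zero_of_profiles_tube (hR : ∀ j, 0 ≤ R.Gfr j) {c : ℝ} (hc : 0 < c) (hcle : c ≤ klCurveC3 R / 16)
    (hU : 0 < U) (hUle : U ≤ klCurveU0 R / 16) (hU1 : U ≤ 1) (hβmin : klBetaMin ≤ β) (hβc : β ≤ Real.exp (c / U ^ 2))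
    (hμ : μ ∈ klWindowC)
    {K : TrigPolyC4v} {Kp : ℕ → TrigPolyC4v} (hK : ∀ p : Fin 2 → ℝ, K.eval p = ∑ m ∈ range (nScales β + 1), (Kp m).eval p)
    (ha : ∀ m ≤ nScales β, ∀ j ≤ 4, ∀ q : Momentum, ‖iteratedFDeriv ℝ j (evalM (Kp m)) q‖ ≤ pieceSize R U m j)
    (hc₀ : Continuous (klLocalPart L M β U μ K 0))
    {S : ℕ → TrigPolyC4v}
    (hS : ∀ θ, klLocalPart L M β U μ K 0 θ - K.eval (klFermiPoint μ K θ) = (S (nScales β)).eval (klFermiPoint μ K θ))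
    {dT : ℝ} {σ : ℕ → ℕ → ℝ} (hσnn : ∀ k l, 0 ≤ σ k l)
    (hσ0 : ∀ k ≤ nScales β, ∀ q : Momentum, |frameLevel μ K q| ≤ dT → |evalM (S k) q| ≤ σ k 0)
    (hσ : ∀ k ≤ nScales β, ∀ l, 1 ≤ l → l ≤ 5 → ∀ q : Momentum, |frameLevel μ K q| ≤ dT → ‖iteratedFDeriv ℝ l (evalM (S k)) q‖ ≤ σ k l)
    {ε : ℕ → ℕ → ℝ} (hεnn : ∀ m l, 0 ≤ ε m l)
    (hε0 : ∀ m ∈ Ioc 0 (nScales β), ∀ q : Momentum,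
      |frameLevel μ K q| ≤ dT → |evalM (fsub (S m) (S (m - 1))) q| ≤ ε m 0)
    (hε : ∀ m ∈ Ioc 0 (nScales β), ∀ l, 1 ≤ l → l ≤ 4 → ∀ q : Momentum,
      |frameLevel μ K q| ≤ dT → ‖iteratedFDeriv ℝ l (evalM (fsub (S m) (S (m - 1)))) q‖ ≤ ε m l)
    {X : ℝ} (hX : ∀ l ≤ 4, ∀ x : ℝ, ‖iteratedFDeriv ℝ l salmhoferCutoff x‖ ≤ X)
    {Gl : ℝ} (hGl : ∀ q : Momentum, ‖fderiv ℝ (frameLevel μ K) q‖ ≤ Gl) (hdT : msTubeR R U 0 Gl ≤ dT)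
    (hCE : 0 ≤ Q.CE) (hS' : ∀ j, 0 ≤ Q.S' j)
    {mu nu : ℕ → ℝ} (hmu : ∀ i, 0 ≤ mu i) (hnu : ∀ i, 0 ≤ nu i)
    (hs0 : σ 0 0 ≤ 16 * mu 0 * U ^ 2)
    (hs1 : ∀ k ≤ nScales β, σ k 1 ≤ 4 * mu 1 * U ^ 2)
    (hs2 : ∀ k ≤ nScales β, σ k 2 ≤ mu 2 * U ^ 2)
    (hs3 : ∀ k ≤ nScales β, σ k 3 ≤ mu 3 * U ^ 2 / 4)
    (hs4 : ∀ k ≤ nScales β, σ k 4 ≤ mu 4 * U ^ 2 / 16)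
    (hs5 : ∀ k ≤ nScales β, σ k 5 ≤ mu 5 * U ^ 2 / 64)
    (he0 : ∀ m ∈ Ioc 0 (nScales β), ε m 0 ≤ nu 0 * U ^ 2 * (R.Gfr 0 * U / ((4 : ℝ) ^ m) ^ 2))
    (he1 : ∀ m ∈ Ioc 0 (nScales β), ε m 1 ≤ nu 1 * U ^ 2 * (R.Gfr 1 * U ^ 2 / (4 : ℝ) ^ m))
    (he2 : ∀ m ∈ Ioc 0 (nScales β), ε m 2 ≤ nu 2 * U ^ 2 * (R.Gfr 2 * U ^ 2))
    (he3 : ∀ m ∈ Ioc 0 (nScales β), ε m 3 ≤ nu 3 * U ^ 2 * (R.Gfr 3 * U ^ 2 * (4 : ℝ) ^ m))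
    (he4 : ∀ m ∈ Ioc 0 (nScales β), ε m 4 ≤ nu 4 * U ^ 2 * (R.Gfr 4 * U ^ 2 * ((4 : ℝ) ^ m) ^ 2))
    (hfit : ∀ j ≤ 4, msReqSlot X (msMuZ mu) (msNuZ nu) (msRenZ R) (8 * π ^ 8) (8 * π ^ 8) j ≤ 64 * (Q.CE * G.S 1 * R.Gfr j) / (4 : ℝ) ^ j)
    (hfit0 : ∀ j ≤ 4, msReqBase0 X (msMuZ mu) j ≤ 8 * G.S j / (4 : ℝ) ^ j)
    (hfit1 : ∀ j ≤ 4, U * msReqBase1 X (msMuZ mu) (msRenZ R) (8 * π ^ 8) (8 * π ^ 8) j ≤ 8 * G.S j / (4 : ℝ) ^ j) :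
    TwoLegSizesMSTQ L M G Q R β U μ K 0 := by
  -- the chain regime at scale `0`
  have hreg := chain_regime_of_pieces_graded hR hc hcle hU hUle hβmin hβc hμ ha (4 ^ 0) (Nat.zero_le (nScales β))
  have hA0 : 0 ≤ msA R c U := msA_nonneg hR hc.le U
  have hA20 : msA R c U ≤ 1 / 20 := hreg.2.1
  have hd : klCurveD ≤ msDt - 2 * msA R c U := hreg.2.2.1
  have hX0 : 0 ≤ X := le_trans (norm_nonneg _) (hX 0 (by norm_num) 0)
  have hlam : (0 : ℝ) ≤ 8 * π ^ 8 := by positivity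
  -- the Λ-shapes at `d = 4^0`
  have hΛ₃0 := msLam_nonneg hR U (4 ^ 0) 0 3
  have hΛ₄0 := msLam_nonneg hR U (4 ^ 0) 0 4
  have hΛ₃ := msLam_three_le_scaleZero hR U
  have hΛ₄ := msLam_four_le_scaleZero hR U
  refine twoLegSizesMSTQ_zero_of_pieces_mixed_tube hR hc hcle hU hUle hβmin hβc hμ hK ha (4 ^ 0) hc₀ hS hσnn hσ0 hσ hεnn hε0 hε hX
    hGl hdT ?_ ?_
  · -- base fits
    exact msPieceBaseL_le_scaleZero hR hU hU1 hX0 hlam hlam hS' hmu hΛ₃0 hΛ₃ hΛ₄0 hΛ₄ hσnn hs0 (hs1 0 (Nat.zero_le _))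
      (hs2 0 (Nat.zero_le _)) (hs3 0 (Nat.zero_le _)) (hs4 0 (Nat.zero_le _)) hfit0 hfit1
  · -- slot fits
    intro m hm
    have hm' : 1 ≤ m := (mem_Ioc.mp hm).1
    have hk : m - 1 ≤ nScales β := by have := (mem_Ioc.mp hm).2; omega
    exact msPieceSlotL_le_scaleZero hR hU hU1 hm' hX0 hlam hlam hCE (hS' 1) hmu hnu hA0 hA20 hd hΛ₃0 hΛ₃ hΛ₄0 hΛ₄ hσnn
      (hs1 _ hk) (hs2 _ hk) (hs3 _ hk) (hs4 _ hk) (hs5 _ hk) hεnn (he0 m hm) (he1 m hm) (he2 m hm) (he3 m hm) (he4 m hm) hfit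

end MS

end Summit.HubbardSuperconductivity.HubbardSuperconductivity.Theorems.KLRegimeSplit

end
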